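import Summits.MatrixMultiplication.MatrixMultiplication.Theorems.SaturationLadderLevelTwoKit
import HarnessLib

/-!
# Level 2 of the saturation ladder — the laser-block kit at `q = 9`
# (route `SaturationLadder`, node `TailDescentTwo`, lens 1, gen 22)

Cell `decomp-mm`, lens 1 («grading / quantitative ladder»), gen 22.  No named facts, no sorry.  The
`q = 9` twins of the three `q = 6` block lemmas of `SaturationLadderLevelTwoKit` (the laser block
`blockOf9` of a word over the level-2 labels for `CW_9^{⊗2}` over `ℂ`, constant runs `blk9`,
concatenations `app9`) and the packing bound `R̃(CW_9^{⊗2}) ≤ 121`; used by the `k = 6` rung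
`ω(1,6,1) ≤ 229/32` (`SaturationLadderLevelTwoK6Word`, `SaturationLadderLevelTwoK6`): under the
format cap `A^6 ≤ B` the `3 : 3 : 2` family kernel is best at `q = 9` (real optima `7.1568 (q=8)`,
`7.1542 (q=9)`, `7.1562 (q=10)`).  The design-independent rest (used support
`supp14`, the zero-row penalty lemma, entropy bookkeeping) is imported from the `q = 6` kit.

## References

* F. Le Gall, *Faster algorithms for rectangular matrix multiplication*, FOCS 2012,
  arXiv:1204.1111, §3, §6.1. [LeGall2012]
* D. Coppersmith, S. Winograd, *Matrix multiplication via arithmetic progressions*,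
  J. Symbolic Comput. 9 (1990), §6, §8. [CoppersmithWinograd1990]
-/

set_option linter.dupNamespace false
set_option autoImplicit false

noncomputable section

open Finset Real
open scoped BigOperators

namespace Summit.MatrixMultiplication.MatrixMultiplication.Theorems.SaturationLadderLevelTwoKit9

open Literature.Computability.AlgebraicComplexity
open Literature.Barriers.MatrixMultiplication (bigCwTensor)
open SaturationLadderLevelTwoKit (PL5)

/-! ## Laser blocks over `CW_9^{⊗2}` -/

/-- The laser block of a word over the level-2 labels, for `CW_9^{⊗2}` over `ℂ`. [folklore] -/
abbrev blockOf9 {d : ℕ} (w : Fin d → PL5) :=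
  laserBlock cwLev2 cwLev2 cwLev2 (bigCwSq ℂ 9) w

/-- A constant run of a component with format value `(1; A, B, C)` is worth `(1; Aⁿ, Bⁿ, Cⁿ)`
(`q = 9`). [folklore] -/
theorem blk9 (s : PL5) (n : ℕ) {A B C : ℝ}
    (h : HasFormatValue (cwSqComp ℂ 9 s.1 s.2.1 s.2.2) 1 A B C)
    (hA : 0 ≤ A := by positivity) (hB : 0 ≤ B := by positivity)
    (hC : 0 ≤ C := by positivity) :
    HasFormatValue (blockOf9 (fun _ : Fin n => s)) 1 (A ^ n) (B ^ n) (C ^ n) := by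
  simpa using h.laserBlock_const cwLev2 cwLev2 cwLev2 (bigCwSq ℂ 9) zero_le_one hA hB hC n

/-- Concatenation multiplies format values (value `1`, `q = 9`). [folklore] -/
theorem app9 {m n : ℕ} {w : Fin m → PL5} {w' : Fin n → PL5} {A B C A' B' C' : ℝ}
    (h : HasFormatValue (blockOf9 w) 1 A B C) (h' : HasFormatValue (blockOf9 w') 1 A' B' C')
    (hA : 0 ≤ A := by positivity) (hA' : 0 ≤ A' := by positivity)
    (hB : 0 ≤ B := by positivity) (hB' : 0 ≤ B' := by positivity)
    (hC : 0 ≤ C := by positivity) (hC' : 0 ≤ C' := by positivity) :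
    HasFormatValue (blockOf9 (Fin.append w w')) 1 (A * A') (B * B') (C * C') := by
  simpa using h.laserBlock_append cwLev2 cwLev2 cwLev2 (bigCwSq ℂ 9) h' zero_le_one zero_le_one
    hA hA' hB hB' hC hC'

/-! ## The packing bound -/

/-- `R̃(CW_9^{⊗2}) ≤ 121` (sub-multiplicativity and the border-rank bound `R̃(CW_q) ≤ q+2`).
[cite: CoppersmithWinograd1990, §6 and §8] -/
theorem asymptoticRank_bigCwSq_nine_le : asymptoticRank (bigCwSq ℂ 9) ≤ 121 := by
  have h := asymptoticRank_bigCwTensor_le ℂ 9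
  have h0 := asymptoticRank_nonneg (bigCwTensor ℂ 9)
  calc asymptoticRank (bigCwSq ℂ 9)
      ≤ asymptoticRank (bigCwTensor ℂ 9) * asymptoticRank (bigCwTensor ℂ 9) :=
        asymptoticRank_kronecker_le _ _
    _ ≤ 11 * 11 :=
        mul_le_mul (by norm_num at h; linarith) (by norm_num at h; linarith) h0 (by norm_num)
    _ = 121 := by norm_num

end Summit.MatrixMultiplication.MatrixMultiplication.Theorems.SaturationLadderLevelTwoKit9

end
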